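import Summits.QuantumFields.YangMills.Theses.CertificationLength
import Summits.QuantumFields.YangMills.Theorems.PencilRigidityDiagonalMirrorRPRStubFortyFiveSwapRP
import Summits.QuantumFields.YangMills.Theorems.PencilRigidityDiagonalMirrorRPRStubRpClosureOffDiag

/-!
# Birth skeleton (BC3) for crux `DiagonalFramesAtCertificationScale` (stmt-QuantumFields-16180) — `Lines/birth.lean`

Registrar: `planner-skel-stmt-QuantumFields-16180-0` (skeleton-register one-shot; route
`route-QuantumFields-CertificationLength`, re-audit bin REPAIRABLE), 2026-08-17.  Line card: `Lines/birth.md`.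

Crux (D) (route file `Theses/CertificationLength.lean`, rank 4, decl
`Summit.QuantumFields.YangMills.Theses.CertificationLength.DiagonalFramesAtCertificationScale`): for every compact
simple `G`, faithful `r`, admissible `(n, ε)` (`ε M(n) < 1`), `ℓ₀ > 0`, cell sizes `b_k`, scheme `sch` and one-species
family `S₁`: if at every `k` the coupling is `β_k ≥ 0` and the Dobrushin–Shlosman TV finite-size condition holds at
`(β_k, b_k)`, the spacing is `a_k = ℓ₀ / b_k`, the tori satisfy `2L_k + 1 ≥ (8n+7) b_k` and `log²(|c_k|+1) ≤ a_k L_k`,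
the renormalised curvature strings converge on `⁰𝒮` (real tensors) to `S₁` and `S₁` is normalised (E0), then `S₁` is
reflection positive in pull-back form in the four diagonal frames `R e₀ = a e₀ + c e₁`, `a² = c² = 1/2` — verbatim
the landed predicate `DiagonalFrameRP S₁` of the sibling crux `DiagonalMirrorRPR` (route PencilRigidity).

## The cut (three named stubs + sorry-free composition)

The landed `DiagonalMirrorRPR` machinery (`Theorems/PencilRigidityDiagonalMirrorRPR*`, line `parity-bridge-cold-traces`
/ `centre-twisted-swap`) proves: swap-RP of Wilson's measure on the FILS 45° cover `T̃_N` for `β ≥ 0`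
(`stub_fortyFiveSwapRP`, LANDED) and the closure "cover swap-RP + cover insensitivity + `hconv` + E0 + `W(B₄)`-covariance
⇒ `DiagonalFrameRP S₁`" (`isReflectionPositive_pullback_offDiag`, LANDED, but with the hypotheses bundled as the full
curvature package `W₁`, of which the proof uses exactly `hconv`, E0 and the `W(B₄)` clause).  Its lead's census
(`Cruxes/DiagonalMirrorRPR/PICKED.md`, c8) isolates what is missing upstream: Q1 = the infinite-volume state at `β_k` is
shape-independent (cubic torus = tilted cover in the limit), Q2 = relative finite-size control of the RENORMALISED
strings.  Crux (D) is designed to make Q1 ∧ Q2 theorems at the certification scale (DS uniqueness + exponential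
boundary-influence decay + the `log²` clause).  Hence:

* `stub_coverInsensitivity_of_certificate` (S1, **the heart, L**): under (D)'s hypotheses up to `hconv`, the torus
  curvature strings and the 45°-cover curvature strings are asymptotically equal on compactly supported, pairwise
  disjoint real tests (`CoverInsensitivityOffDiag r sch`, landed predicate).  Mechanism: both periodic states satisfy
  the `ℤ⁴` DLR equations on embedded cubes; the certificate gives the unique bulk state (support
  `UniqueStateFromCertificate`, PROVED) and the influence bound `‖A‖_∞ · #cells · (εM)^⌊dist/((2n+1)b_k)⌋` with
  `dist/b_k ≍ a_k L_k / ℓ₀ → ∞`; `‖A‖_∞ ≲ (|c_k|(C + |m_k|) ‖f‖₁)^m` is beaten thanks to `log²(|c_k|+1) ≤ a_k L_k` (and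
  `|c_k m_k| = O(|c_k| + 1)` from `hconv` in degree 1).  Why it might fail: the DS influence bound must be made
  quantitative in `‖A‖_∞` and in the support radius `R b_k/ℓ₀ → ∞` of `A` (the landed decay lemma
  `stub_boxInfluenceDecayAt_of_cellFiniteSize` has an `A`-dependent constant), and the cover `T̃_N` must be shown to be
  DLR-consistent with the `ℤ⁴` Wilson specification on embedded cubes.
* `stub_signedPermutationInvariance_of_limit` (S2, **the hidden covariance, M–L, risky**): under the same hypotheses,
  `S₁` is invariant on `⁰𝒮` under the proper signed permutations of `ℝ⁴` (the `W(B₄)` clause of `W₁`, verbatim).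
  (D) has no such hypothesis, yet two of its four frames (mirror `x₀ = −x₁`) are reached in the landed closure only by
  a proper sign flip of a canonical frame (mirror `x₀ = x₁`): at lattice level the curvature discretisation (plaquettes
  BASED at `x`) is covariant under pure axis permutations only, so the swap `x₀ ↔ x₁` is exact while `x₁ ↦ −x₁` moves
  single-plane plaquettes by plane-dependent one-link shifts.  Why it might fail: (D)'s hypotheses control only the
  summed six-plane strings; the `O(a_k)` shift artefacts are single-plane (spin-2 channel) strings which no clause
  bounds — physically `O(a_k log^p)`, but not derivable softly.  NOTE FOR THE TENURE PLANNER: `closes` applies (D) to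
  the curvature channel of the full family `S`, which carries the `W(B₄)` clause (`hhyp₁`); restating (D) with that
  clause as an extra hypothesis deletes S2 from this skeleton at no cost to the route.
* `stub_frameRP_closure` (S3, **provable now, M**): `hconv` → E0 → `W(B₄)`-covariance → cover swap-RP at every `k` with
  `N_k ≥ 2` → `CoverInsensitivityOffDiag` → `DiagonalFrameRP S₁`.  This is the landed
  `isReflectionPositive_pullback_offDiag` / `stub_rpClosureOffDiag` with `CurvaturePackage` unbundled to the three
  components its proof actually uses (a replay / refactor, no new mathematics).
* `DiagonalFramesAtCertificationScale_of` — the composition (hypothesis form, sorry-free): `β_k ≥ 0` is the first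
  conjunct of the certificate clause, cover swap-RP comes from the LANDED `stub_fortyFiveSwapRP` (FILS, `β ≥ 0`,
  `N ≥ 2`), S1 and S2 are fed (D)'s hypotheses, S3 closes; `DiagonalFramesAtCertificationScale_of_stubs` is the same
  with the three stubs plugged in BY NAME (concludes the crux decl by name, modulo `sorryAx` of the stubs only).

## Disproof / negatives honoured

No `Cruxes/DiagonalFramesAtCertificationScale/Disproof.lean` exists (no workfiles before this one).  Sibling negatives
(`Theorems/DiagonalMirrorRPR/Negative/*`): `HconvLoadBearing` / `PhantomFunctional` (any proof must use `hconv`) — `hconv`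
is load-bearing in S1, S2, S3; `SquareTorusNotSwapRP`, `OddTorusTwist` — no RP is asserted on the statement's odd cubic
torus: RP lives on the 45° cover (landed) and reaches the torus only through S1; `L1GaussianNotDiagonalRP` — the line is
action-specific (Wilson weight, `β_k ≥ 0`).  `ledger negatives --problem QuantumFields`: the refuted
`MirrorModularBoosts.DiagonalMirrorRP` (stmt-9665, `S₁ 0` free) is excluded — S3 carries E0, S1/S2 conclude no RP.
Junk audit: with `c ≡ 0` (or any scheme whose strings vanish on `⁰𝒮`) S1's conclusion holds trivially, S2's holds
(`S₁ = 0` on `⁰𝒮` in degrees `≥ 1`, `κ ∫` in degree 1), and S3 returns RP of a constant/vacuum family — consistent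
with refuter rreview-0816T16-4's finding that no `β ≡ 0` scheme refutes (D).

## Audit (registrar folder `bc/`, 2026-08-17)

`lean check --json` on this file: rc 0, errors [], sorries = 3 = stubs (`stub_coverInsensitivity_of_certificate`,
`stub_signedPermutationInvariance_of_limit`, `stub_frameRP_closure`), zero elsewhere; audit counts
`{proof-of-item: 1, proof.conditional: 1, support: 3, vendored-fact: 6}` — `DiagonalFramesAtCertificationScale_of_stubs`
class proof-of-item, target `Summit.QuantumFields.YangMills.Theses.CertificationLength.DiagonalFramesAtCertificationScale`
BY NAME ("NOT closed: axioms [sorryAx]" = the three stubs); `DiagonalFramesAtCertificationScale_of` class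
proof.conditional (hypothesis form over the three named statements); the six `vendored-fact` entries are the untagged
statement/clause `def … : Prop` of §0–§1 (they credit nothing, as intended).  BC3 probes (`bc/*_probe*.lean`, importing
ONLY the route file + the landed vocabulary module `…StubRpClosureOffDiag`, with verbatim copies of §0–§1; the birth
file NOT imported): combined form `first | exact? | simpa | simpa [Stubᵢ] | (unfold Stubᵢ; simpa) | aesop`,
`maxHeartbeats 400000`: 6/6 FAIL (deterministic timeout at `whnf`); per tactic after `intro h`: 18/18 FAIL (`exact?`:
"could not close the goal" ×6; `aesop`: "failed, made no progress" ×6; `simpa using h`: type mismatch ×6); converse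
`crux → Stubᵢ`, `YangMills → Stubᵢ`: 6/6 FAIL; dedup `example : Stubᵢ := by exact?`: 3/3 MISS.  Verdict: bc3 PASS.
-/

set_option autoImplicit false

noncomputable section

namespace Summit.QuantumFields.YangMills.Cruxes.DiagonalFramesAtCertificationScale.Birth

open scoped SchwartzMap
open MeasureTheory Filter Topology
open Literature.MathematicalPhysics.QuantumLattice Literature.MathematicalPhysics.AQFT
  Literature.MathematicalPhysics.QuantumFieldTheory
open Summit.QuantumFields.YangMills.Cruxes.DiagonalMirrorRPR.ParityBridgeColdTraces

/-! ## §0 Vocabulary: the clauses of the crux, verbatim -/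

section Clauses

variable {G : Type} [Group G] [TopologicalSpace G] [IsTopologicalGroup G] [CompactSpace G]
  [MeasurableSpace G] [BorelSpace G]

/-- **The Dobrushin–Shlosman total-variation finite-size condition** at representation `ρ`, inverse coupling `β`,
cell size `b`, shell parameter `n` and threshold `ε` — VERBATIM the clause of the crux (and of
`CompleteAnalyticityAtLargeScales`, `UniqueStateFromCertificate`, `FiniteSizeCriterion`): for every `[b,2b]`-frame `w`
of `ℤ⁴`, every cell union `Y ∋ 0` inside the cube of `(4n+1)⁴` cells, every two exterior fields agreeing on that cube
and every `[0,1]`-valued measurable cylinder function `f` of the central cell, the two `γ_Y`-expectations of `f` differ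
by at most `ε`. [folklore] -/
def TVFiniteSize {N : ℕ} (ρ : G →* Matrix (Fin N) (Fin N) ℂ) (β : ℝ) (b n : ℕ) (ε : ℝ) : Prop :=
  ∀ w : Fin 4 → ℤ → ℤ, (∀ i j, w i j + ((b : ℕ) : ℤ) ≤ w i (j + 1) ∧ w i (j + 1) ≤ w i j + 2 * ((b : ℕ) : ℤ)) → ∀ Y : Finset (Fin 4 → ℤ), Y ⊆ (Fintype.piFinset fun _ : Fin 4 => Finset.Icc (-(2 * ((n : ℕ) : ℤ))) (2 * ((n : ℕ) : ℤ))) → (0 : Fin 4 → ℤ) ∈ Y → ∀ η η' : LGConfig 4 G, (∀ e ∈ (Fintype.piFinset fun _ : Fin 4 => Finset.Icc (-(2 * ((n : ℕ) : ℤ))) (2 * ((n : ℕ) : ℤ))).biUnion (fun y : Fin 4 → ℤ => (Fintype.piFinset fun i : Fin 4 => Finset.Ico (w i (y i)) (w i (y i + 1))) ×ˢ (Finset.univ : Finset (Fin 4))), η e = η' e) → ∀ f : LGConfig 4 G → ℝ, IsCylinder f ((fun y : Fin 4 → ℤ => (Fintype.piFinset fun i : Fin 4 => Finset.Ico (w i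 (y i)) (w i (y i + 1))) ×ˢ (Finset.univ : Finset (Fin 4))) 0) → Measurable f → (∀ U, 0 ≤ f U ∧ f U ≤ 1) → |(∫ U, f U ∂(ymSpecification ρ β (Y.biUnion (fun y : Fin 4 → ℤ => (Fintype.piFinset fun i : Fin 4 => Finset.Ico (w i (y i)) (w i (y i + 1))) ×ˢ (Finset.univ : Finset (Fin 4)))) η)) - ∫ U, f U ∂(ymSpecification ρ β (Y.biUnion (fun y : Fin 4 → ℤ => (Fintype.piFinset fun i : Fin 4 => Finset.Ico (w i (y i)) (w i (y i + 1))) ×ˢ (Finset.univ : Finset (Fin 4)))) η')| ≤ ε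

/-- **Convergence of the renormalised curvature strings** along `sch` to `S₁` on `⁰𝒮` (real tensors) — VERBATIM the
`hconv` clause of the crux (= the first conjunct of the landed `CurvaturePackage`). [folklore] -/
def CurvatureStringsConverge (r : LatticeRep G) (sch : SpeciesScheme (YMSpecies G)) (S₁ : SchwingerFamily E4) :
    Prop :=
  ∀ (n : ℕ), n ≠ 0 → ∀ (f : Fin n → 𝓢(E4, ℝ)) (F : 𝓢((Fin n → E4), ℂ)),
    IsTensorOf F (fun i => ofRealTest (f i)) → IsOffDiagonal F →
      Tendsto (fun k : ℕ => ((latticeSchwinger r.ρ sch (fun s => s.F) k n (fun _ => r.curvature) f : ℝ) : ℂ))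
        atTop (𝓝 (S₁ n F))

end Clauses

/-- **Proper signed-permutation (`W(B₄)⁺`) invariance of `S₁` on `⁰𝒮`** — VERBATIM the fourth conjunct of the landed
`CurvaturePackage` (the clause the landed closure uses to bring every diagonal frame to a canonical one). [folklore] -/
def SignedPermutationInvariant (S₁ : SchwingerFamily E4) : Prop :=
  ∀ (R : E4 ≃ₗᵢ[ℝ] E4), LinearMap.det (R.toLinearEquiv : E4 →ₗ[ℝ] E4) = 1 →
    (∀ i : Fin 4, ∃ j : Fin 4, R (EuclideanSpace.single i 1) = EuclideanSpace.single j 1 ∨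
      R (EuclideanSpace.single i 1) = -EuclideanSpace.single j 1) →
    ∀ (n : ℕ) (F : 𝓢((Fin n → E4), ℂ)), IsOffDiagonal F → S₁ n (linActMulti R F) = S₁ n F

/-! ## §1 The three stub statements -/

/-- Statement of S1 (`stub_coverInsensitivity_of_certificate`): along a certified scheme (the crux's hypotheses up to
and including `hconv`), the cubic-torus curvature strings and the 45°-cover curvature strings are asymptotically equal on
compactly supported, pairwise disjoint real tests. -/
def CoverInsensitivityOfCertificate : Prop :=
  ∀ (G : Type) [Group G] [TopologicalSpace G] [IsTopologicalGroup G] [CompactSpace G] [MeasurableSpace G]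
    [BorelSpace G], IsCompactSimpleLieGroup G →
    ∀ (r : LatticeRep G) (n : ℕ) (ε : ℝ), 1 ≤ n → 0 ≤ ε →
      ε * ((((4 * n + 3) ^ 4 - (4 * n + 1) ^ 4 : ℕ)) : ℝ) < 1 →
      ∀ (ℓ₀ : ℝ) (bseq : ℕ → ℕ) (sch : SpeciesScheme (YMSpecies G)) (S₁ : SchwingerFamily E4), 0 < ℓ₀ →
        (∀ k, 0 ≤ sch.β k ∧ 1 ≤ bseq k ∧ TVFiniteSize r.ρ (sch.β k) (bseq k) n ε) →
        (∀ k, sch.a k = ℓ₀ / (bseq k : ℝ)) →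
        (∀ k, (8 * n + 7) * bseq k ≤ 2 * sch.L k + 1 ∧
          Real.log (|sch.c r.curvature k| + 1) ^ 2 ≤ sch.a k * sch.L k) →
        CurvatureStringsConverge r sch S₁ →
          CoverInsensitivityOffDiag r sch

/-- Statement of S2 (`stub_signedPermutationInvariance_of_limit`): along a certified scheme, the continuum limit `S₁` of
the curvature strings is invariant on `⁰𝒮` under the proper signed permutations of `ℝ⁴`. -/
def SignedPermutationInvarianceOfLimit : Prop :=
  ∀ (G : Type) [Group G] [TopologicalSpace G] [IsTopologicalGroup G] [CompactSpace G] [MeasurableSpace G]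
    [BorelSpace G], IsCompactSimpleLieGroup G →
    ∀ (r : LatticeRep G) (n : ℕ) (ε : ℝ), 1 ≤ n → 0 ≤ ε →
      ε * ((((4 * n + 3) ^ 4 - (4 * n + 1) ^ 4 : ℕ)) : ℝ) < 1 →
      ∀ (ℓ₀ : ℝ) (bseq : ℕ → ℕ) (sch : SpeciesScheme (YMSpecies G)) (S₁ : SchwingerFamily E4), 0 < ℓ₀ →
        (∀ k, 0 ≤ sch.β k ∧ 1 ≤ bseq k ∧ TVFiniteSize r.ρ (sch.β k) (bseq k) n ε) →
        (∀ k, sch.a k = ℓ₀ / (bseq k : ℝ)) →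
        (∀ k, (8 * n + 7) * bseq k ≤ 2 * sch.L k + 1 ∧
          Real.log (|sch.c r.curvature k| + 1) ^ 2 ≤ sch.a k * sch.L k) →
        CurvatureStringsConverge r sch S₁ →
          SignedPermutationInvariant S₁

/-- Statement of S3 (`stub_frameRP_closure`): the closure step with unbundled hypotheses — `hconv`, E0,
`W(B₄)⁺`-covariance of `S₁`, swap-RP of Wilson's measure on the 45° cover `T̃_{N_k}` at every `k` with `N_k ≥ 2`, and
cover insensitivity on disjoint compact real tests imply RP of `S₁` in pull-back form in the four diagonal frames. -/
def FrameRPClosure : Prop :=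
  ∀ (G : Type) [Group G] [TopologicalSpace G] [IsTopologicalGroup G] [CompactSpace G] [MeasurableSpace G]
    [BorelSpace G], IsCompactSimpleLieGroup G →
    ∀ (r : LatticeRep G) (sch : SpeciesScheme (YMSpecies G)) (S₁ : SchwingerFamily E4),
      CurvatureStringsConverge r sch S₁ → S₁.toLabelled.IsNormalized → SignedPermutationInvariant S₁ →
        (∀ k, 2 ≤ sch.side k → CoverSwapRPAt r.ρ (sch.β k) (sch.side k)) →
          CoverInsensitivityOffDiag r sch → DiagonalFrameRP S₁

/-! ## §2 The stubs -/

/-- **S1 (L) — `stub_coverInsensitivity_of_certificate`, the infrared heart (Q1 ∧ Q2 at the certification scale).**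
Torus strings and cover strings of the renormalised curvature field are both exponentially close (in the number of cells
`≍ a_k L_k/ℓ₀ → ∞` between a compact physical support and the seam) to the strings of the unique bulk state that the
certificate provides; the prefactor `‖A‖_∞ ≲ (|c_k|(C+|m_k|)‖f‖₁)^m` is beaten through `log²(|c_k|+1) ≤ a_k L_k`. -/
theorem stub_coverInsensitivity_of_certificate :
    ∀ (G : Type) [Group G] [TopologicalSpace G] [IsTopologicalGroup G] [CompactSpace G] [MeasurableSpace G]
      [BorelSpace G], IsCompactSimpleLieGroup G →
      ∀ (r : LatticeRep G) (n : ℕ) (ε : ℝ), 1 ≤ n → 0 ≤ ε →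
        ε * ((((4 * n + 3) ^ 4 - (4 * n + 1) ^ 4 : ℕ)) : ℝ) < 1 →
        ∀ (ℓ₀ : ℝ) (bseq : ℕ → ℕ) (sch : SpeciesScheme (YMSpecies G)) (S₁ : SchwingerFamily E4), 0 < ℓ₀ →
          (∀ k, 0 ≤ sch.β k ∧ 1 ≤ bseq k ∧ TVFiniteSize r.ρ (sch.β k) (bseq k) n ε) →
          (∀ k, sch.a k = ℓ₀ / (bseq k : ℝ)) →
          (∀ k, (8 * n + 7) * bseq k ≤ 2 * sch.L k + 1 ∧
            Real.log (|sch.c r.curvature k| + 1) ^ 2 ≤ sch.a k * sch.L k) →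
          CurvatureStringsConverge r sch S₁ →
            CoverInsensitivityOffDiag r sch := by
  sorry

/-- **S2 (M–L) — `stub_signedPermutationInvariance_of_limit`, the hidden covariance.** The continuum limit on `⁰𝒮` of
the torus curvature strings is invariant under proper signed permutations; exact on the lattice for pure axis
permutations (based-plaquette discretisation), up to one-link single-plane shifts for sign changes. -/
theorem stub_signedPermutationInvariance_of_limit :
    ∀ (G : Type) [Group G] [TopologicalSpace G] [IsTopologicalGroup G] [CompactSpace G] [MeasurableSpace G]
      [BorelSpace G], IsCompactSimpleLieGroup G →
      ∀ (r : LatticeRep G) (n : ℕ) (ε : ℝ), 1 ≤ n → 0 ≤ ε →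
        ε * ((((4 * n + 3) ^ 4 - (4 * n + 1) ^ 4 : ℕ)) : ℝ) < 1 →
        ∀ (ℓ₀ : ℝ) (bseq : ℕ → ℕ) (sch : SpeciesScheme (YMSpecies G)) (S₁ : SchwingerFamily E4), 0 < ℓ₀ →
          (∀ k, 0 ≤ sch.β k ∧ 1 ≤ bseq k ∧ TVFiniteSize r.ρ (sch.β k) (bseq k) n ε) →
          (∀ k, sch.a k = ℓ₀ / (bseq k : ℝ)) →
          (∀ k, (8 * n + 7) * bseq k ≤ 2 * sch.L k + 1 ∧
            Real.log (|sch.c r.curvature k| + 1) ^ 2 ≤ sch.a k * sch.L k) →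
          CurvatureStringsConverge r sch S₁ →
            SignedPermutationInvariant S₁ := by
  sorry

/-- **S3 (M, provable now) — `stub_frameRP_closure`.** Replay of the landed `isReflectionPositive_pullback_offDiag`
(`Theorems/PencilRigidityDiagonalMirrorRPRStubRpClosureOffDiag`) with `CurvaturePackage` unbundled to `hconv`, E0 and
the `W(B₄)⁺` clause (the only components that proof destructures). -/
theorem stub_frameRP_closure :
    ∀ (G : Type) [Group G] [TopologicalSpace G] [IsTopologicalGroup G] [CompactSpace G] [MeasurableSpace G]
      [BorelSpace G], IsCompactSimpleLieGroup G →
      ∀ (r : LatticeRep G) (sch : SpeciesScheme (YMSpecies G)) (S₁ : SchwingerFamily E4),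
        CurvatureStringsConverge r sch S₁ → S₁.toLabelled.IsNormalized → SignedPermutationInvariant S₁ →
          (∀ k, 2 ≤ sch.side k → CoverSwapRPAt r.ρ (sch.β k) (sch.side k)) →
            CoverInsensitivityOffDiag r sch → DiagonalFrameRP S₁ := by
  sorry

/-- Readback: the three stub types ARE the three named statements (definitionally). -/
example : (CoverInsensitivityOfCertificate ↔
      ∀ (G : Type) [Group G] [TopologicalSpace G] [IsTopologicalGroup G] [CompactSpace G] [MeasurableSpace G]
        [BorelSpace G], IsCompactSimpleLieGroup G →
        ∀ (r : LatticeRep G) (n : ℕ) (ε : ℝ), 1 ≤ n → 0 ≤ ε →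
          ε * ((((4 * n + 3) ^ 4 - (4 * n + 1) ^ 4 : ℕ)) : ℝ) < 1 →
          ∀ (ℓ₀ : ℝ) (bseq : ℕ → ℕ) (sch : SpeciesScheme (YMSpecies G)) (S₁ : SchwingerFamily E4), 0 < ℓ₀ →
            (∀ k, 0 ≤ sch.β k ∧ 1 ≤ bseq k ∧ TVFiniteSize r.ρ (sch.β k) (bseq k) n ε) →
            (∀ k, sch.a k = ℓ₀ / (bseq k : ℝ)) →
            (∀ k, (8 * n + 7) * bseq k ≤ 2 * sch.L k + 1 ∧
              Real.log (|sch.c r.curvature k| + 1) ^ 2 ≤ sch.a k * sch.L k) →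
            CurvatureStringsConverge r sch S₁ →
              CoverInsensitivityOffDiag r sch) ∧
    (SignedPermutationInvarianceOfLimit ↔
      ∀ (G : Type) [Group G] [TopologicalSpace G] [IsTopologicalGroup G] [CompactSpace G] [MeasurableSpace G]
        [BorelSpace G], IsCompactSimpleLieGroup G →
        ∀ (r : LatticeRep G) (n : ℕ) (ε : ℝ), 1 ≤ n → 0 ≤ ε →
          ε * ((((4 * n + 3) ^ 4 - (4 * n + 1) ^ 4 : ℕ)) : ℝ) < 1 →
          ∀ (ℓ₀ : ℝ) (bseq : ℕ → ℕ) (sch : SpeciesScheme (YMSpecies G)) (S₁ : SchwingerFamily E4), 0 < ℓ₀ →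
            (∀ k, 0 ≤ sch.β k ∧ 1 ≤ bseq k ∧ TVFiniteSize r.ρ (sch.β k) (bseq k) n ε) →
            (∀ k, sch.a k = ℓ₀ / (bseq k : ℝ)) →
            (∀ k, (8 * n + 7) * bseq k ≤ 2 * sch.L k + 1 ∧
              Real.log (|sch.c r.curvature k| + 1) ^ 2 ≤ sch.a k * sch.L k) →
            CurvatureStringsConverge r sch S₁ →
              SignedPermutationInvariant S₁) ∧
    (FrameRPClosure ↔
      ∀ (G : Type) [Group G] [TopologicalSpace G] [IsTopologicalGroup G] [CompactSpace G] [MeasurableSpace G]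
        [BorelSpace G], IsCompactSimpleLieGroup G →
        ∀ (r : LatticeRep G) (sch : SpeciesScheme (YMSpecies G)) (S₁ : SchwingerFamily E4),
          CurvatureStringsConverge r sch S₁ → S₁.toLabelled.IsNormalized → SignedPermutationInvariant S₁ →
            (∀ k, 2 ≤ sch.side k → CoverSwapRPAt r.ρ (sch.β k) (sch.side k)) →
              CoverInsensitivityOffDiag r sch → DiagonalFrameRP S₁) :=
  ⟨Iff.rfl, Iff.rfl, Iff.rfl⟩

/-- The stubs inhabit the named statements (term-level, no tactic). -/
example : CoverInsensitivityOfCertificate ∧ SignedPermutationInvarianceOfLimit ∧ FrameRPClosure :=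
  ⟨stub_coverInsensitivity_of_certificate, stub_signedPermutationInvariance_of_limit, stub_frameRP_closure⟩

/-! ## §3 The composition (sorry-free) -/

/-- **Composition, hypothesis form** — S1 → S2 → S3 → the crux BY NAME.  `β_k ≥ 0` is the first conjunct of the
certificate clause; swap-RP on the cover `T̃_{N_k}` is the LANDED `stub_fortyFiveSwapRP` (FILS 45° torus, `β ≥ 0`,
`N ≥ 2`); S1 and S2 consume the crux's hypotheses; S3 closes.  No `sorry` here. -/
theorem DiagonalFramesAtCertificationScale_of :
    CoverInsensitivityOfCertificate → SignedPermutationInvarianceOfLimit → FrameRPClosure →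
      Summit.QuantumFields.YangMills.Theses.CertificationLength.DiagonalFramesAtCertificationScale := by
  intro h1 h2 h3 G _ _ _ _ hG
  letI : MeasurableSpace G := borel G
  haveI : BorelSpace G := ⟨rfl⟩
  intro r n ε hn hε hM ℓ₀ bseq sch S₁ hℓ hcert ha hL hconv hE0
  -- S1: cover insensitivity of the certified scheme (DS comparison torus ↔ bulk ↔ cover)
  have hCI : CoverInsensitivityOffDiag r sch := h1 G hG r n ε hn hε hM ℓ₀ bseq sch S₁ hℓ hcert ha hL hconv
  -- S2: proper signed-permutation covariance of the limit
  have hrot : SignedPermutationInvariant S₁ := h2 G hG r n ε hn hε hM ℓ₀ bseq sch S₁ hℓ hcert ha hL hconv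
  -- LANDED (FILS 1978 Thm 2.1 on the tilted torus): swap-RP of Wilson's measure on `T̃_{N_k}`, `β_k ≥ 0`, `N_k ≥ 2`
  have hRP : ∀ k, 2 ≤ sch.side k → CoverSwapRPAt r.ρ (sch.β k) (sch.side k) := fun k hk =>
    stub_fortyFiveSwapRP G r.N r.ρ r.continuous r.mem_unitary (sch.β k) (hcert k).1 (sch.side k) hk
  -- S3: closure in every diagonal frame
  exact h3 G hG r sch S₁ hconv hE0 hrot hRP hCI

/-- **Composition, registered form** — the crux decl BY NAME from the three stubs BY NAME (closed modulo the `sorryAx`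
of `stub_*` only). -/
theorem DiagonalFramesAtCertificationScale_of_stubs :
    Summit.QuantumFields.YangMills.Theses.CertificationLength.DiagonalFramesAtCertificationScale :=
  DiagonalFramesAtCertificationScale_of stub_coverInsensitivity_of_certificate
    stub_signedPermutationInvariance_of_limit stub_frameRP_closure

/-- Signature match (kernel-checked): the crux's conclusion IS the landed `DiagonalFrameRP`, and its convergence clause IS
`CurvatureStringsConverge` — the readback used by the composition, recorded as a definitional `example`. -/
example {G : Type} [Group G] [TopologicalSpace G] [IsTopologicalGroup G] [CompactSpace G]
    (r : @LatticeRep G _ _) (sch : SpeciesScheme (@YMSpecies G _ (borel G)))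
    (S₁ : SchwingerFamily E4) :
    letI : MeasurableSpace G := borel G
    haveI : BorelSpace G := ⟨rfl⟩
    (CurvatureStringsConverge r sch S₁ ↔
      ∀ (m : ℕ), m ≠ 0 → ∀ (f : Fin m → SchwartzMap E4 ℝ) (F : SchwartzMap (Fin m → E4) ℂ),
        IsTensorOf F (fun i => ofRealTest (f i)) → IsOffDiagonal F →
          Filter.Tendsto (fun k : ℕ => ((latticeSchwinger r.ρ sch (fun s => s.F) k m (fun _ => r.curvature) f : ℝ) : ℂ))
            Filter.atTop (nhds (S₁ m F))) ∧
    (DiagonalFrameRP S₁ ↔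
      ∀ (R : E4 ≃ₗᵢ[ℝ] E4) (a c : ℝ), a ^ 2 = 1 / 2 → c ^ 2 = 1 / 2 →
        R (EuclideanSpace.single 0 1) = a • EuclideanSpace.single 0 1 + c • EuclideanSpace.single 1 1 →
          (SchwingerFamily.toLabelled (fun m => (S₁ m).comp (linActMulti R))).IsReflectionPositive) :=
  ⟨Iff.rfl, Iff.rfl⟩

end Summit.QuantumFields.YangMills.Cruxes.DiagonalFramesAtCertificationScale.Birth

end
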